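import Summits.QuantumFields.QCD.Theorems.HeatSlicedQuarksQuarkLoopCoefficientDefs

/-!
# Helper for stub `stub_torusToPlane` (line `Sketch`, crux `QuarkLoopCoefficient`, item stmt-QuantumFields-16786): gauge and translation covariance on `ℤ⁴`

Pure algebra on the definitions `diracKer`, `sqKer`, `sqKerPow`, `heatKer`, `symLink`, `symHeat` of
`HeatSlicedQuarksQuarkLoopCoefficientDefs`:

* conjugation covariance under an abelian gauge transformation `g : ℤ⁴ → U(1)`,
  `(g • v)(z, μ) = g(z) v(z, μ) conj (g (z + e_μ))`: every kernel `K ∈ {D, D♯D, (D♯D)ⁿ, e^{−tD♯D}}`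
  transforms as `K_{g•v}(x, y) = g(x) conj (g y) · K_v(x, y)`;
* translation covariance: `K_{v(· + a)}(x, y) = K_v(x + a, y + a)`;
* the symmetric-gauge field `symLink θ` translated by `a` is the gauge transform of itself by the
  magnetic-translation phase `z ↦ exp(−i (θ/2) a ∧ z)`, whence
  `e^{−tH_θ}(x, y) = exp(i (θ/2) x ∧ (y − x)) · symHeat θ t (y − x)`.
-/

noncomputable section

namespace Summit.QuantumFields.QCD.Cruxes.QuarkLoopCoefficient.Sketch.TorusToPlane

open Summit.QuantumFields.QCD.Theorems.QuarkLoopCoefficient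
open Literature.MathematicalPhysics.QuantumLattice Literature.MathematicalPhysics.QuantumFieldTheory
open Literature.Probability.LatticeModels (Site TorusSite)
open scoped Matrix ComplexConjugate

/-! ### Gauge conjugation on `ℤ⁴` -/

section Gauge

variable {g : Site 4 → ℂ} (hg : ∀ z, ‖g z‖ = 1) (v : LGConfig 4 ℂ)

include hg in
/-- Gauge covariance of the abelian Wilson–Dirac kernel on `ℤ⁴`:
`D_{g•v}(x, y) = g(x) conj (g y) · D_v(x, y)`. -/
theorem diracKer_gauge (x y : Site 4) :
    diracKer (fun e => g e.1 * v e * conj (g (e.1 + Pi.single e.2 1))) x y =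
      (g x * conj (g y)) • diracKer v x y := by
  have h0 : (if x = y then (4 : ℂ) • (1 : Spin) else 0) =
      (g x * conj (g y)) • (if x = y then (4 : ℂ) • (1 : Spin) else 0) := by
    by_cases h : x = y
    · subst h
      rw [if_pos rfl, (by rw [Complex.mul_conj', hg x]; simp : g x * conj (g x) = 1), one_smul]
    · rw [if_neg h, smul_zero]
  have h1 : ∀ μ : Fin 4,
      (if y = x + Pi.single μ 1 then
          (g x * v (x, μ) * conj (g (x + Pi.single μ 1))) • ((1 : Spin) - euclideanGamma μ) else 0) =
        (g x * conj (g y)) • (if y = x + Pi.single μ 1 then v (x, μ) • ((1 : Spin) - euclideanGamma μ)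
          else 0) := by
    intro μ
    by_cases h : y = x + Pi.single μ 1
    · subst h
      rw [if_pos rfl, if_pos rfl, smul_smul]
      congr 1
      ring
    · rw [if_neg h, if_neg h, smul_zero]
  have h2 : ∀ μ : Fin 4,
      (if x = y + Pi.single μ 1 then
          conj (g y * v (y, μ) * conj (g (y + Pi.single μ 1))) • ((1 : Spin) + euclideanGamma μ) else 0) =
        (g x * conj (g y)) • (if x = y + Pi.single μ 1 then conj (v (y, μ)) • ((1 : Spin) + euclideanGamma μ)
          else 0) := by
    intro μ
    by_cases h : x = y + Pi.single μ 1
    · subst h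
      rw [if_pos rfl, if_pos rfl, smul_smul, map_mul, map_mul, Complex.conj_conj]
      congr 1
      ring
    · rw [if_neg h, if_neg h, smul_zero]
  unfold diracKer
  conv_lhs => rw [h0]
  simp only [h1, h2]
  rw [smul_sub, smul_comm (g x * conj (g y)) (1 / 2 : ℂ)]
  simp only [Finset.smul_sum, smul_add]

include hg in
/-- Gauge covariance of the squared kernel `D♯D` on `ℤ⁴`. -/
theorem sqKer_gauge (x y : Site 4) :
    sqKer (fun e => g e.1 * v e * conj (g (e.1 + Pi.single e.2 1))) x y =
      (g x * conj (g y)) • sqKer v x y := by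
  unfold sqKer
  rw [Finset.smul_sum]
  refine Finset.sum_congr rfl fun z _ => ?_
  rw [diracKer_gauge hg, diracKer_gauge hg, Matrix.conjTranspose_smul, Matrix.smul_mul,
    Matrix.mul_smul, smul_smul]
  congr 1
  simp only [star_mul', Complex.star_def, Complex.conj_conj]
  linear_combination (g x * conj (g y)) * (by rw [Complex.conj_mul', hg z]; simp : conj (g z) * g z = 1)

include hg in
/-- Gauge covariance of the kernel powers `(D♯D)ⁿ` on `ℤ⁴`. -/
theorem sqKerPow_gauge (n : ℕ) (x y : Site 4) :
    sqKerPow (fun e => g e.1 * v e * conj (g (e.1 + Pi.single e.2 1))) n x y =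
      (g x * conj (g y)) • sqKerPow v n x y := by
  induction n generalizing x y with
  | zero =>
    simp only [sqKerPow]
    by_cases h : x = y
    · subst h
      rw [if_pos rfl, (by rw [Complex.mul_conj', hg x]; simp : g x * conj (g x) = 1), one_smul]
    · rw [if_neg h, smul_zero]
  | succ n ih =>
    simp only [sqKerPow]
    rw [Finset.smul_sum]
    refine Finset.sum_congr rfl fun z _ => ?_
    rw [sqKer_gauge hg, ih, Matrix.smul_mul, Matrix.mul_smul, smul_smul]
    congr 1
    linear_combination (g x * conj (g y)) * (by rw [Complex.conj_mul', hg z]; simp : conj (g z) * g z = 1)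

include hg in
/-- Gauge covariance of the heat kernel `e^{−tD♯D}` on `ℤ⁴` (termwise in the exponential series). -/
theorem heatKer_gauge (t : ℝ) (x y : Site 4) :
    heatKer (fun e => g e.1 * v e * conj (g (e.1 + Pi.single e.2 1))) t x y =
      (g x * conj (g y)) • heatKer v t x y := by
  unfold heatKer
  rw [← tsum_const_smul'']
  refine tsum_congr fun n => ?_
  rw [sqKerPow_gauge hg, smul_comm]

end Gauge

/-! ### Translations on `ℤ⁴` -/

section Translate

variable (v : LGConfig 4 ℂ) (a : Site 4)

/-- Membership in the range-one neighbourhood `nbr x`. -/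
theorem mem_nbr_iff (x z : Site 4) :
    z ∈ nbr x ↔ z = x ∨ ∃ μ : Fin 4, z = x + Pi.single μ 1 ∨ z = x - Pi.single μ 1 := by
  simp [nbr]

/-- `nbr` is translation covariant. -/
theorem add_mem_nbr {x z : Site 4} (a : Site 4) (h : z ∈ nbr x) : z + a ∈ nbr (x + a) := by
  rw [mem_nbr_iff] at h ⊢
  rcases h with rfl | ⟨μ, rfl | rfl⟩
  · exact Or.inl rfl
  · exact Or.inr ⟨μ, Or.inl (add_right_comm _ _ _)⟩
  · exact Or.inr ⟨μ, Or.inr (sub_add_eq_add_sub _ _ _)⟩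

/-- `nbr` is translation covariant (subtractive form). -/
theorem sub_mem_nbr {x z : Site 4} (a : Site 4) (h : z ∈ nbr (x + a)) : z - a ∈ nbr x := by
  simpa [sub_eq_add_neg, add_assoc] using add_mem_nbr (-a) h

/-- `nbr2` is translation covariant. -/
theorem add_mem_nbr2 {x z : Site 4} (a : Site 4) (h : z ∈ nbr2 x) : z + a ∈ nbr2 (x + a) := by
  simp only [nbr2, Finset.mem_biUnion] at h ⊢
  obtain ⟨w, hw, hz⟩ := h
  exact ⟨w + a, add_mem_nbr a hw, add_mem_nbr a hz⟩

/-- `nbr2` is translation covariant (subtractive form). -/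
theorem sub_mem_nbr2 {x z : Site 4} (a : Site 4) (h : z ∈ nbr2 (x + a)) : z - a ∈ nbr2 x := by
  simpa [sub_eq_add_neg, add_assoc] using add_mem_nbr2 (-a) h

/-- Translation covariance of the Wilson–Dirac kernel: `D_{v(·+a)}(x, y) = D_v(x + a, y + a)`. -/
theorem diracKer_translate (x y : Site 4) :
    diracKer (fun e => v (e.1 + a, e.2)) x y = diracKer v (x + a) (y + a) := by
  unfold diracKer
  have e1 : (x + a = y + a) = (x = y) := propext (add_left_inj a)
  have e2 : ∀ μ : Fin 4, (y + a = x + a + Pi.single μ 1) = (y = x + Pi.single μ 1) := fun μ => by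
    rw [add_right_comm, propext (add_left_inj a)]
  have e3 : ∀ μ : Fin 4, (x + a = y + a + Pi.single μ 1) = (x = y + Pi.single μ 1) := fun μ => by
    rw [add_right_comm, propext (add_left_inj a)]
  simp only [e1, e2, e3]

/-- Translation covariance of `D♯D`. -/
theorem sqKer_translate (x y : Site 4) :
    sqKer (fun e => v (e.1 + a, e.2)) x y = sqKer v (x + a) (y + a) := by
  unfold sqKer
  refine Finset.sum_nbij' (· + a) (· - a) (fun z hz => add_mem_nbr a hz) (fun w hw => sub_mem_nbr a hw)
    (fun z _ => by simp) (fun w _ => by simp) (fun z _ => ?_)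
  rw [diracKer_translate, diracKer_translate]

/-- Translation covariance of the kernel powers `(D♯D)ⁿ`. -/
theorem sqKerPow_translate (n : ℕ) (x y : Site 4) :
    sqKerPow (fun e => v (e.1 + a, e.2)) n x y = sqKerPow v n (x + a) (y + a) := by
  induction n generalizing x y with
  | zero => simp only [sqKerPow, add_left_inj]
  | succ n ih =>
    simp only [sqKerPow]
    refine Finset.sum_nbij' (· + a) (· - a) (fun z hz => add_mem_nbr2 a hz)
      (fun w hw => sub_mem_nbr2 a hw) (fun z _ => by simp) (fun w _ => by simp) (fun z _ => ?_)
    rw [sqKer_translate, ih]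

/-- Translation covariance of the heat kernel `e^{−tD♯D}`. -/
theorem heatKer_translate (t : ℝ) (x y : Site 4) :
    heatKer (fun e => v (e.1 + a, e.2)) t x y = heatKer v t (x + a) (y + a) := by
  unfold heatKer
  exact tsum_congr fun n => by rw [sqKerPow_translate]

end Translate

/-! ### Magnetic translations of the symmetric gauge -/

section Magnetic

/-- The symmetric-gauge potential translated by `x` differs from itself by the gradient of the
magnetic phase `z ↦ (1/2) x ∧ z` (componentwise identity, times `θ`). -/
theorem symPotential_translate (θ : ℝ) (x z : Site 4) (μ : Fin 4) :
    θ * symPotential (z + x) μ =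
      -(θ / 2 * (wedge x z : ℝ)) + θ * symPotential z μ + θ / 2 * (wedge x (z + Pi.single μ 1) : ℝ) := by
  fin_cases μ <;> simp [symPotential, wedge] <;> ring

/-- The symmetric-gauge field translated by `x` is the gauge transform of itself by the magnetic
phase `g_x(z) = exp(−i (θ/2) x ∧ z)`. -/
theorem symLink_translate (θ : ℝ) (x : Site 4) :
    (fun e : ZdEdge 4 => symLink θ (e.1 + x, e.2)) = fun e =>
      Complex.exp (((-(θ / 2 * (wedge x e.1 : ℝ)) : ℝ) : ℂ) * Complex.I) * symLink θ e *
        conj (Complex.exp (((-(θ / 2 * (wedge x (e.1 + Pi.single e.2 1) : ℝ)) : ℝ) : ℂ) * Complex.I)) := by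
  funext e
  simp only [symLink]
  rw [← Complex.exp_conj, ← Complex.exp_add, ← Complex.exp_add]
  congr 1
  simp only [map_mul, Complex.conj_ofReal, Complex.conj_I, symPotential_translate]
  push_cast
  ring

/-- The magnetic phase has unit modulus. -/
theorem norm_magneticPhase (θ : ℝ) (x z : Site 4) :
    ‖Complex.exp (((-(θ / 2 * (wedge x z : ℝ)) : ℝ) : ℂ) * Complex.I)‖ = 1 :=
  Complex.norm_exp_ofReal_mul_I _

/-- `x ∧ 0 = 0`. -/
theorem wedge_zero_right (x : Site 4) : wedge x 0 = 0 := by simp [wedge]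

/-- **Magnetic-translation covariance of the symmetric-gauge heat kernel**:
`e^{−tH_θ}(x, y) = exp(i (θ/2) x ∧ (y − x)) · symHeat θ t (y − x)`. -/
theorem heatKer_symLink (θ t : ℝ) (x y : Site 4) :
    heatKer (symLink θ) t x y =
      Complex.exp (((θ / 2 * (wedge x (y - x) : ℝ) : ℝ) : ℂ) * Complex.I) • symHeat θ t (y - x) := by
  have h := heatKer_translate (symLink θ) x t 0 (y - x)
  rw [zero_add, sub_add_cancel] at h
  rw [← h, symLink_translate, heatKer_gauge (norm_magneticPhase θ x), symHeat]
  congr 1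
  rw [wedge_zero_right, ← Complex.exp_conj, ← Complex.exp_add]
  congr 1
  simp only [map_mul, Complex.conj_ofReal, Complex.conj_I]
  push_cast
  ring

end Magnetic

/-! ### Registered headline -/

/-- Registered headline of this helper file (aux stub `stub_torusToPlaneAux` of crux
stmt-QuantumFields-16786, line `Sketch`): magnetic-translation covariance of the symmetric-gauge heat
kernel, `e^{−tH_θ}(x, y) = exp(i (θ/2) x ∧ (y − x)) · symHeat θ t (y − x)`. -/
theorem stub_torusToPlaneAux :
    ∀ (θ t : ℝ) (x y : Site 4), heatKer (symLink θ) t x y =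
      Complex.exp (((θ / 2 * (wedge x (y - x) : ℝ) : ℝ) : ℂ) * Complex.I) • symHeat θ t (y - x) :=
  heatKer_symLink

end Summit.QuantumFields.QCD.Cruxes.QuarkLoopCoefficient.Sketch.TorusToPlane

end
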